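import Summits.BirchSwinnertonDyer.Rank1Residual.Additive.GordManinConstantDegree
import Summits.BirchSwinnertonDyer.Rank1Residual.Additive.X4RankZeroKatoBound
import HarnessLib

/-!
# X4 at an additive prime: the Kato-14.5(3) route, the tame `p = 3`, and the per-pair Kim
# certificates with the MANIN datum from the modular degree (Česnavičius–Neururer–Saha 2024 Thm. 1.2)

HONEST FRAMING (cell `b2b-bsdres`, run/shared/lean/b2b/bsd-rank1-residual/, verbatim in every
file): the goal of the cell is to DELETE the COMBINATION-SHAPED residual classes of the
Birch–Swinnerton-Dyer formula for ALL analytic-rank `≤ 1` elliptic curves over `ℚ` — "full BSD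
formula for every rank `≤ 1` curve in class `C`" assembled STRICTLY from published theorems — so
that the rank-`≤ 1` remainder becomes exactly the CONSTRUCTION-SHAPED classes, which are TYPED
(missing-input `Prop`s), NOT attempted. This is not "finishing BSD". Sub-cell `additive-p2`
(CLASS-OWNERS row "X3/X4 additive — pot. good ordinary / X3♯(G-ord)"), generation 16: research
route; no claim beyond the stated classes; theorems only, no definition, no new named fact minted
here (the PUBLISHED named facts `hKato` = Kato 2004 Thm. 14.5 (3) (additive-p4, p239919), `hKim` =
Kim 2026 Thm. 1.8 and `hCNS` = Česnavičius–Neururer–Saha 2024 Thm. 1.2 (A159) enter as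
hypotheses); X3♯(G-ord)/X4♯(G-ord) stay CONSTRUCTION-SHAPED; no label moves; nothing is booked.

WHAT THIS FILE DOES (sibling of `GordManinConstantDegree.lean`, which carries the bridge
`f₃ ≤ 2 ⟹ 3³ ∤ N ⟹ (3 ∤ deg ⟹ 3 ∤ c)` and the Kim / Kolyvagin class consumers). With the Manin
datum `p ∤ c(D)` replaced by the decidable `p ∤ deg(D)` for a conductor-level parametrisation datum
`D` of ANY member (Česnavičius–Neururer–Saha: `val_p(c_φ) ≤ val_p(deg φ)` at every `p ≥ 5`, and at
`p = 3` when `27 ∤ N`):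
* Kato 2004 Thm. 14.5 (3) route (additive-p4's `X4RankZero.…_of_kato`: X4 ∧ `r_an = 0` at an odd
  POTENTIALLY GOOD additive `p`, `ρ̄_{E,p^n}` onto for all `n` = Kato's (12.5.2), `p ∤ ∏ c_ℓ`):
  `X4RankZero.missingUpperBoundAt_of_kato_of_not_dvd_modularDegree`,
  `…bsdp_of_missingLowerBoundAt_of_kato_of_not_dvd_modularDegree`,
  `…bsdp_of_shaAn_unit_of_kato_of_not_dvd_modularDegree` (`p ≥ 5`: the defect-3,4,6 rows of
  X4♯(G-ord) at `p ∈ {5, 7}` and the potentially supersingular X4 rows alike), and at a TAME `3`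
  (`f₃ ≤ 2`: Kodaira I₀* = the (G-ord) cell at `3`, or III/III*) in the census shape surj(3) ∧
  ram(3): `X4RankZero.bsdp_three_of_kato_of_surj_of_ram_of_condExp_le_two_of_not_dvd_modularDegree`,
  `X4RankZero.missingUpperBoundAt_three_…`. Nothing is asserted on the WILD locus `f₃ ≥ 3` (the
  printed clause "`val_3(N) ≥ 3` and no `p' ∣ N` with `p' ≡ 2 mod 3`" may apply there).
* Per-pair Kim certificates (the lane's T-KIM0/T-KIM1 rows, `X4/OptimalPeriod.lean`): optimality
  stays ONLY as the PERIOD binder `Ω(W) = |c|·Ω⁺_f`; the Manin datum goes: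
  `X4.bsdp_of_kim_rankZero_of_optimal_of_not_dvd_modularDegree`,
  `X4.bsdp_of_kim_rankOne_of_optimal_of_not_dvd_modularDegree` (EVERY `p ≥ 5`, any reduction).
* Reading on the (G)-ordinary cell: `ClassX4Gord.bsdp_rankZero_of_kato_of_not_dvd_modularDegree`
  (X4♯(G-ord) ∧ `r = 0`, every `p ≥ 5`, tower surjectivity, `p ∤ ∏ c_ℓ`, `p ∤ deg`: `BSD(E,p)` from
  the LOWER half alone; `ord_p j ≥ 0` is automatic on the cell).
EFFECT: with gen 14 (Edixhoven, strong curve, `p ≥ 11`, outside (G-ord) ∩ {II,III,IV}) and the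
sibling file, every Kim / Kato / Kolyvagin consumer of the additive cells has its Manin datum either
discharged in print or reduced to ONE class integer per member (`p ∤ deg φ`, Cremona `alldegphi`);
census `HOME/b2b-bsdres-additive-p2/census/gen16/`. The located gap (the LOWER half) is untouched:
labels UNCHANGED; nothing booked.

References: K. Česnavičius, M. Neururer, A. Saha, J. Eur. Math. Soc. 26 (2024) 573–637, Thm. 1.2
[CesnaviciusNeururerSaha2023]; K. Kato, Astérisque 295 (2004) Thm. 14.5 (3), Prop. 14.16 (2),
(12.5.2) [Kato2004Asterisque]; C.-H. Kim, Amer. J. Math. 148 (2026) Thm. 1.8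
[Kim2022StructureSelmer]; A. Agashe–K. Ribet–W. Stein, PAMQ 2 (2006) Thm. 2.6 (optimal periods)
[AgasheRibetStein2006]; R. L. Miller, LMS J. Comput. Math. 14 (2011) Def. 1.1 [Miller2011LMS].
-/

noncomputable section

open scoped Classical NumberField

open WeierstrassCurve IsDedekindDomain IsDedekindDomain.HeightOneSpectrum NumberField
  Rat.HeightOneSpectrum Literature.NumberTheory.EllipticCurves
  Literature.NumberTheory.EllipticCurves.ModularForms
  Literature.NumberTheory.EllipticCurves.Rank1Residual
  Literature.NumberTheory.EllipticCurves.Rank1Residual.Typed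
  Literature.NumberTheory.DiophantineGeometry

namespace Summit.BirchSwinnertonDyer.Rank1Residual.Additive

variable (W : WeierstrassCurve ℚ) [W.IsElliptic] [W.IsGloballyMinimal] (p : ℕ) [hp : Fact p.Prime]

/-! #### Kato 2004 Thm. 14.5 (3) route (odd potentially good additive `p`, tower surjectivity) -/

/-- **The typed UPPER half on X4 ∧ `r = 0` at a potentially good additive `p ≥ 5` with
`ρ̄_{E,p^n}` onto for all `n`, `p ∤ ∏ c_ℓ`, ANY member, `p ∤ deg(D)`** — additive-p4's
`X4RankZero.missingUpperBoundAt_of_kato` (Kato 2004 Thm. 14.5 (3) + Prop. 14.16 (2) `hKato`; GZK;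
modularity) with the Manin datum from the modular degree (`hCNS`). Serves the defect-3,4,6 rows of
X4♯(G-ord) at `p ∈ {5, 7}` (where the branch route of gen 12/13 has no printed input) and the
potentially supersingular X4 rows alike. [cite: Kato2004Asterisque, Thm. 14.5 (3) (p. 236), (12.5.2) (p. 222)]
[cite: CesnaviciusNeururerSaha2023, Thm. 1.2] -/
theorem X4RankZero.missingUpperBoundAt_of_kato_of_not_dvd_modularDegree
    (hKato : Kato2004.rankZero_padicValNat_sha_le_of_additive_potGood_of_imageContainsSL2)
    (hGZK : rank_eq_analyticRank_of_analyticRank_le_one) (hmod : hasEntireLFunction_rat)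
    (hCNS : cesnaviciusNeururerSaha_padicVal_maninConstant_le_modularDegree)
    (hp5 : 5 ≤ p) (hr : W.analyticRank = 0) (hX : ClassX4 W p) (hpot : 0 ≤ padicValRat p W.j)
    (hsurj : ∀ n : ℕ, W.HasSurjectiveModNGaloisRep (p ^ n : ℕ)) (htam : ¬ p ∣ W.tamagawaProduct)
    [NeZero (W.conductorNorm ℤ)] (D : ModularParametrizationData W (W.conductorNorm ℤ))
    (hdeg : ¬ p ∣ D.modularDegree) : MissingUpperBoundAt W p :=
  X4RankZero.missingUpperBoundAt_of_kato W p hKato hGZK hmod hr hX hpot hsurj htam D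
    (not_dvd_maninConstant_of_not_dvd_modularDegree hCNS W D hp.out hp5 hdeg)

/-- **`BSD(E,p)` from the LOWER half alone** on X4 ∧ `r = 0` at a potentially good additive
`p ≥ 5`, tower surjectivity, `p ∤ ∏ c_ℓ`, ANY member, `p ∤ deg(D)`.
[cite: Kato2004Asterisque, Thm. 14.5 (3) (p. 236)] [cite: Miller2011LMS, §1 and Def. 1.1]
[cite: CesnaviciusNeururerSaha2023, Thm. 1.2] -/
theorem X4RankZero.bsdp_of_missingLowerBoundAt_of_kato_of_not_dvd_modularDegree
    (hKato : Kato2004.rankZero_padicValNat_sha_le_of_additive_potGood_of_imageContainsSL2)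
    (hGZK : rank_eq_analyticRank_of_analyticRank_le_one) (hmod : hasEntireLFunction_rat)
    (hCNS : cesnaviciusNeururerSaha_padicVal_maninConstant_le_modularDegree)
    (hp5 : 5 ≤ p) (hr : W.analyticRank = 0) (hX : ClassX4 W p) (hpot : 0 ≤ padicValRat p W.j)
    (hsurj : ∀ n : ℕ, W.HasSurjectiveModNGaloisRep (p ^ n : ℕ)) (htam : ¬ p ∣ W.tamagawaProduct)
    [NeZero (W.conductorNorm ℤ)] (D : ModularParametrizationData W (W.conductorNorm ℤ))
    (hdeg : ¬ p ∣ D.modularDegree) (hlow : MissingLowerBoundAt W p) : BSDp W p :=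
  X4RankZero.bsdp_of_missingLowerBoundAt_of_kato W p hKato hGZK hmod hr hX hpot hsurj htam D
    (not_dvd_maninConstant_of_not_dvd_modularDegree hCNS W D hp.out hp5 hdeg) hlow

/-- **`BSD(E,p)` WITHOUT a lower-half input on the `p ∤ #Ш_an` rows**: X4 ∧ `r = 0`, potentially
good additive `p ≥ 5`, tower surjectivity, `p ∤ ∏ c_ℓ`, ANY member, `p ∤ deg(D)`, `#Ш_an = q` with
`ord_p q = 0`. [cite: Kato2004Asterisque, Thm. 14.5 (3) (p. 236)] [cite: Miller2011LMS, §1 and Def. 1.1]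
[cite: CesnaviciusNeururerSaha2023, Thm. 1.2] -/
theorem X4RankZero.bsdp_of_shaAn_unit_of_kato_of_not_dvd_modularDegree
    (hKato : Kato2004.rankZero_padicValNat_sha_le_of_additive_potGood_of_imageContainsSL2)
    (hGZK : rank_eq_analyticRank_of_analyticRank_le_one) (hmod : hasEntireLFunction_rat)
    (hCNS : cesnaviciusNeururerSaha_padicVal_maninConstant_le_modularDegree)
    (hp5 : 5 ≤ p) (hr : W.analyticRank = 0) (hX : ClassX4 W p) (hpot : 0 ≤ padicValRat p W.j)
    (hsurj : ∀ n : ℕ, W.HasSurjectiveModNGaloisRep (p ^ n : ℕ)) (htam : ¬ p ∣ W.tamagawaProduct)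
    [NeZero (W.conductorNorm ℤ)] (D : ModularParametrizationData W (W.conductorNorm ℤ))
    (hdeg : ¬ p ∣ D.modularDegree) {q : ℚ} (hq : shaAn W = (q : ℂ)) (hv : padicValRat p q = 0) :
    BSDp W p :=
  X4RankZero.bsdp_of_shaAn_unit_of_kato W p hKato hGZK hmod hr hX hpot hsurj htam D
    (not_dvd_maninConstant_of_not_dvd_modularDegree hCNS W D hp.out hp5 hdeg) hq hv

/-- **`p = 3` in the census shape, the Manin datum from the modular degree**: X4 ∧ `r_an = 0` at a
potentially good additive `3` with `f₃ = f₃(E) ≤ 2` (TAME: Kodaira I₀* — the (G-ord) cell at `3` —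
or III/III*), surj(3), ram(3), `3 ∤ ∏ c_ℓ`, `3 ∤ deg(D)` for a conductor-level datum `D` of ANY
member, `#Ш_an` a `3`-unit: Miller's `BSD(E,3)` — additive-p4's
`X4RankZero.bsdp_three_of_kato_of_surj_of_ram` (Kato 2004 Thm. 14.5 (3) `hKato`, GZK, modularity)
with `3 ∤ c_D` supplied by Česnavičius–Neururer–Saha (`hCNS`; the printed `3³ ∣ N` clause is void
on the tame locus). On the WILD locus (`f₃ ≥ 3`) the printed clause may apply and nothing is
asserted here. [cite: Kato2004Asterisque, Thm. 14.5 (3) (p. 236), (12.5.2) (p. 222)]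
[cite: CesnaviciusNeururerSaha2023, Thm. 1.2] [cite: Miller2011LMS, §1 and Def. 1.1] -/
theorem X4RankZero.bsdp_three_of_kato_of_surj_of_ram_of_condExp_le_two_of_not_dvd_modularDegree
    (hKato : Kato2004.rankZero_padicValNat_sha_le_of_additive_potGood_of_imageContainsSL2)
    (hGZK : rank_eq_analyticRank_of_analyticRank_le_one) (hmod : hasEntireLFunction_rat)
    (hCNS : cesnaviciusNeururerSaha_padicVal_maninConstant_le_modularDegree)
    (W : WeierstrassCurve ℚ) [W.IsElliptic] [W.IsGloballyMinimal]
    (hr : W.analyticRank = 0) (hX : ClassX4 W 3) (hpot : 0 ≤ padicValRat 3 W.j) (hsurj : Surj W 3)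
    (hram : Ram W 3) (hf : condExp W 3 ≤ 2) (htam : ¬ 3 ∣ W.tamagawaProduct)
    [NeZero (W.conductorNorm ℤ)] (D : ModularParametrizationData W (W.conductorNorm ℤ))
    (hdeg : ¬ 3 ∣ D.modularDegree) {q : ℚ} (hq : shaAn W = (q : ℂ)) (hv : padicValRat 3 q = 0) :
    BSDp W 3 :=
  X4RankZero.bsdp_three_of_kato_of_surj_of_ram W hKato hGZK hmod hr hX hpot hsurj hram htam D
    (not_three_dvd_maninConstant_of_condExp_le_two_of_not_dvd_modularDegree hCNS W D hf hdeg) hq hv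

/-- **The typed upper half at a tame `3` in the census shape** (surj(3) ∧ ram(3), `3 ∤ ∏ c_ℓ`,
`f₃ ≤ 2`, `3 ∤ deg(D)`, `ord_3 j ≥ 0`, ANY member): `MissingUpperBoundAt W 3` — also on the rows
with `3 ∣ #Ш_an`, where the LOWER half is what remains. [cite: Kato2004Asterisque, Thm. 14.5 (3) (p. 236)]
[cite: CesnaviciusNeururerSaha2023, Thm. 1.2] [cite: Miller2011LMS, Def. 1.1] -/
theorem X4RankZero.missingUpperBoundAt_three_of_kato_of_surj_of_ram_of_condExp_le_two_of_not_dvd_modularDegree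
    (hKato : Kato2004.rankZero_padicValNat_sha_le_of_additive_potGood_of_imageContainsSL2)
    (hGZK : rank_eq_analyticRank_of_analyticRank_le_one) (hmod : hasEntireLFunction_rat)
    (hCNS : cesnaviciusNeururerSaha_padicVal_maninConstant_le_modularDegree)
    (W : WeierstrassCurve ℚ) [W.IsElliptic] [W.IsGloballyMinimal]
    (hr : W.analyticRank = 0) (hX : ClassX4 W 3) (hpot : 0 ≤ padicValRat 3 W.j) (hsurj : Surj W 3)
    (hram : Ram W 3) (hf : condExp W 3 ≤ 2) (htam : ¬ 3 ∣ W.tamagawaProduct)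
    [NeZero (W.conductorNorm ℤ)] (D : ModularParametrizationData W (W.conductorNorm ℤ))
    (hdeg : ¬ 3 ∣ D.modularDegree) : MissingUpperBoundAt W 3 :=
  X4RankZero.missingUpperBoundAt_three_of_kato_of_surj_of_ram W hKato hGZK hmod hr hX hpot hsurj hram
    htam D (not_three_dvd_maninConstant_of_condExp_le_two_of_not_dvd_modularDegree hCNS W D hf hdeg)

/-! #### Per-pair Kim certificates: the Manin datum from the modular degree (optimality = period binder only) -/

/-- **Rank `0`, `p ≥ 5`, OPTIMAL curve with `p ∤ deg(D)`: Kim's Kurihara-number certificate gives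
`BSD(E,p)` with NO Manin datum** — `X4.bsdp_of_kim_rankZero_of_optimal` (Kim 2026 Thm. 1.8 (6)
`hKim`, GZK; `ρ̄` onto, `L(E,1) ≠ 0`, `p ∤ ∏ c_ℓ`, ONE unit Kurihara number at a cyclic Kolyvagin
level) with its input `p ∤ c` supplied by Česnavičius–Neururer–Saha 2024 Thm. 1.2 (`hCNS`) for a
datum `D` AT THE CONDUCTOR LEVEL; optimality (`Λ_E ⊆ c·Λ_f`) remains only as the period binder
`Ω(W) = |c|·Ω⁺_f`. ANY reduction at `p` (additive `p ∈ {5, 7}` and X4♯(G-ord) ∩ {II,III,IV}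
included). Per pair; not a class theorem. [cite: Kim2022StructureSelmer, Thm. 1.8 (6) and §1.3.5 (journal)]
[cite: CesnaviciusNeururerSaha2023, Thm. 1.2] [cite: Miller2011LMS, Def. 1.1] -/
theorem X4.bsdp_of_kim_rankZero_of_optimal_of_not_dvd_modularDegree
    (hKim : Kim2022_rankZero_padicValRat_sha_of_kuriharaNumber_ne_zero_of_maninConstant)
    (hGZK : rank_eq_analyticRank_of_analyticRank_le_one)
    (hCNS : cesnaviciusNeururerSaha_padicVal_maninConstant_le_modularDegree)
    (hp5 : 5 ≤ p) (hsurj : W.HasSurjectiveModNGaloisRep p) (hL : W.entireLFunction 1 ≠ 0)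
    [NeZero (W.conductorNorm ℤ)] (D : ModularParametrizationData W (W.conductorNorm ℤ))
    (hopt : ∀ z ∈ D.L.lattice, ∃ w ∈ periodLattice D.f, z = D.c * w)
    (hdeg : ¬ p ∣ D.modularDegree) (htam : ¬ p ∣ W.tamagawaProduct)
    (n : ℕ) [NeZero n] (hn : Kato.IsKolyvaginProduct W p 1 n)
    (hcyc : ∀ (ℓ : ℕ) [Fact ℓ.Prime], ℓ ∣ n →
      Nat.card {P : ((WeierstrassCurve.integralModelInt W).map
          (Int.castRingHom (ZMod ℓ))).toAffine.Point // p • P = 0} ≤ p)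
    (ψ : (ℓ : ℕ) → (ZMod ℓ)ˣ →* Multiplicative (ZMod (p ^ 1)))
    (hψ : ∀ ℓ ∈ n.primeFactors, Function.Surjective (ψ ℓ))
    (hδ : kuriharaNumber D.f (p ^ 1) n ψ ≠ 0) : BSDp W p :=
  X4.bsdp_of_kim_rankZero_of_optimal W p hKim hGZK hp5 hsurj hL D hopt
    (not_dvd_maninConstant_of_not_dvd_modularDegree hCNS W D hp.out hp5 hdeg) htam n hn hcyc ψ hψ hδ

/-- **Rank `1`, `p ≥ 5`, OPTIMAL curve with `p ∤ deg(D)`: Kim's certificate at a prime Kolyvagin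
level gives `BSD(E,p)` on the `p ∤ #Ш_an` rows with NO Manin datum** — `X4.bsdp_of_kim_rankOne_of_optimal`
(Kim 2026 Thm. 1.8 (1), (4), (6) `hKim`, GZK) with `p ∤ c` from the modular degree (`hCNS`). Per
pair; not a class theorem. [cite: Kim2022StructureSelmer, Thm. 1.8 (1), (4), (6) and §1.3.5 (journal)]
[cite: CesnaviciusNeururerSaha2023, Thm. 1.2] [cite: Miller2011LMS, Def. 1.1] -/
theorem X4.bsdp_of_kim_rankOne_of_optimal_of_not_dvd_modularDegree
    (hKim : Kim2022_rankOne_card_sha_eq_one_of_kuriharaNumber_ne_zero_of_maninConstant)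
    (hGZK : rank_eq_analyticRank_of_analyticRank_le_one)
    (hCNS : cesnaviciusNeururerSaha_padicVal_maninConstant_le_modularDegree)
    (hp5 : 5 ≤ p) (hsurj : W.HasSurjectiveModNGaloisRep p) (hL : W.entireLFunction 1 = 0)
    (hr : W.analyticRank = 1)
    [NeZero (W.conductorNorm ℤ)] (D : ModularParametrizationData W (W.conductorNorm ℤ))
    (hopt : ∀ z ∈ D.L.lattice, ∃ w ∈ periodLattice D.f, z = D.c * w)
    (hdeg : ¬ p ∣ D.modularDegree)
    (ℓ : ℕ) [Fact ℓ.Prime] (hℓ : Kato.IsKolyvaginPrime W p 1 ℓ)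
    (hcyc : Nat.card {P : ((WeierstrassCurve.integralModelInt W).map
        (Int.castRingHom (ZMod ℓ))).toAffine.Point // p • P = 0} ≤ p)
    (ψ : (ℓ' : ℕ) → (ZMod ℓ')ˣ →* Multiplicative (ZMod (p ^ 1)))
    (hψ : Function.Surjective (ψ ℓ)) (hδ : kuriharaNumber D.f (p ^ 1) ℓ ψ ≠ 0)
    {q : ℚ} (hq : shaAn W = (q : ℂ)) (hv : padicValRat p q = 0) : BSDp W p :=
  X4.bsdp_of_kim_rankOne_of_optimal W p hKim hGZK hp5 hsurj hL hr D hopt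
    (not_dvd_maninConstant_of_not_dvd_modularDegree hCNS W D hp.out hp5 hdeg) ℓ hℓ hcyc ψ hψ hδ hq hv

/-! ### Reading on the (G)-ordinary cell -/

/-- **X4♯(G-ord) ∧ `r = 0`, EVERY `p ≥ 5`, `ρ̄_{E,p^n}` onto for all `n`, `p ∤ ∏ c_ℓ`, ANY member,
`p ∤ deg(D)`: `BSD(E,p)` from the LOWER half alone by Kato's route** (`ord_p j ≥ 0` is automatic on
the (G)-cell, `padicValRat_j_nonneg_of_typeGOrd`) — the reading for the defect-3,4,6 rows at
`p ∈ {5, 7}`, where neither Edixhoven (`p > 7`) nor the branch route (no printed input off defect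
`2`) reaches. [cite: Kato2004Asterisque, Thm. 14.5 (3) (p. 236), (12.5.2) (p. 222)]
[cite: CesnaviciusNeururerSaha2023, Thm. 1.2] [cite: Miller2011LMS, §1 and Def. 1.1] -/
theorem ClassX4Gord.bsdp_rankZero_of_kato_of_not_dvd_modularDegree
    (hKato : Kato2004.rankZero_padicValNat_sha_le_of_additive_potGood_of_imageContainsSL2)
    (hGZK : rank_eq_analyticRank_of_analyticRank_le_one) (hmod : hasEntireLFunction_rat)
    (hCNS : cesnaviciusNeururerSaha_padicVal_maninConstant_le_modularDegree)
    (hp5 : 5 ≤ p) (hr : W.analyticRank = 0) (hX : ClassX4Gord W p)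
    (hsurj : ∀ n : ℕ, W.HasSurjectiveModNGaloisRep (p ^ n : ℕ)) (htam : ¬ p ∣ W.tamagawaProduct)
    [NeZero (W.conductorNorm ℤ)] (D : ModularParametrizationData W (W.conductorNorm ℤ))
    (hdeg : ¬ p ∣ D.modularDegree) (hlow : MissingLowerBoundAt W p) : BSDp W p :=
  X4RankZero.bsdp_of_missingLowerBoundAt_of_kato_of_not_dvd_modularDegree W p hKato hGZK hmod hCNS hp5
    hr hX.1 (padicValRat_j_nonneg_of_typeGOrd W p hX.2) hsurj htam D hdeg hlow

end Summit.BirchSwinnertonDyer.Rank1Residual.Additive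

end
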